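import Literature.FieldTheory.Separability.FormallySmoothAlgebraic
import Mathlib.LinearAlgebra.Span.Basic
import HarnessLib

/-!
# Derivations dual to a `p`-free family (Matsumura §26, `p`-bases and derivations)

Topic: `Literature/FieldTheory/Separability`. Matsumura (*Commutative Ring Theory*, §26,
p. 202): for a `p`-basis `B` of a field `K` of characteristic `p`, "any map `D : B → K` has a
unique extension to an element `D ∈ Der(K)`". This file proves the finite, choice-free shadow
of this statement that the Jacobian criterion for `k[X_1, …, X_n]` over an IMPERFECT field
consumes (Matsumura Thm. 30.5, proof of (1) ⇒ (2): "`df_1, …, df_r` can be expressed using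
`dX_1, …, dX_n` together with finitely many `du_α, …, du_γ`"), namely:

* `IsPFree p S` — a finite set `S ⊆ K` is **`p`-free** if no `s ∈ S` lies in the subfield
  `K^p(S ∖ {s})` (for `p = char K`; `p`-independent sets in Matsumura's sense are `p`-free, and
  so are minimal `p`-generating sets, which is all we use);
* `exists_isPFree_subset` — every finite `C ⊆ K` contains a `p`-free `S` with `C ⊆ K^p(S)`
  (take `S ⊆ C` minimal with `C ⊆ K^p(S)`);
* `exists_dual_derivation` — for `S` `p`-free there are derivations `∂_s ∈ Der(K)`, `s ∈ S`,
  with `∂_s(t) = δ_{st}` (Zorn's lemma on the partial derivations of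
  `FormallySmoothAlgebraic.lean`: `PartialDerivation.exists_extension_top`);
* `Derivation.eqOn_subfieldClosure` — two derivations of a field agreeing on a set agree on the
  subfield it generates;
* `derivation_apply_eq_sum_dual` — **expansion along dual derivations**: for any derivation `d`
  of `K` into a `K`-vector space and `c ∈ K^p(S)`, `d c = Σ_{s ∈ S} ∂_s(c) · d(s)`.

## References

* H. Matsumura, *Commutative Ring Theory*, CUP 1986, §26, p. 202 (= PDF p. 220 of the held
  copy: `p`-independence, `p`-bases, extension of maps on a `p`-basis to derivations) and
  Thm. 30.5, proof, p. 235 (= PDF p. 253). [Matsumura1987]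
-/

noncomputable section

open Polynomial

namespace Literature.FieldTheory.Separability

universe u v

variable {E : Type u} [Field E] (p : ℕ)

/-! ## Extending partial derivations to the whole field -/

namespace PartialDerivation

variable {p}

/-- **Every partial derivation extends to a derivation of the whole field** (Zorn's lemma along
`p`-th root extensions `F ⊂ F(z)`, `PartialDerivation.extend`). [cite: Matsumura1987, §26
p. 202] -/
theorem exists_extension_top [Fact p.Prime] [CharP E p] (P : PartialDerivation (E := E) p) :
    ∃ Q : PartialDerivation (E := E) p, P ≤ Q ∧ Q.F = ⊤ := by
  classical
  obtain ⟨M, hPM, hM⟩ := zorn_le_nonempty₀ (Set.univ : Set (PartialDerivation (E := E) p))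
    (fun c _ hc Q hQ => by
      obtain ⟨ub, hub⟩ := PartialDerivation.exists_upperBound c hc ⟨Q, hQ⟩
      exact ⟨ub, Set.mem_univ _, hub⟩) P (Set.mem_univ _)
  refine ⟨M, hPM, ?_⟩
  by_contra htop
  obtain ⟨z, hz⟩ : ∃ z : E, z ∉ M.F := by
    by_contra h
    push Not at h
    exact htop (eq_top_iff.mpr fun z _ => h z)
  exact hz ((hM.2 (Set.mem_univ _) (M.le_extend hz 0)).1 (M.mem_extend_F hz 0))

variable (p) in
/-- The zero partial derivation on a subfield containing all `p`-th powers. [folklore] -/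
def ofSubfield (F : Subfield E) (hF : ∀ x : E, x ^ p ∈ F) : PartialDerivation (E := E) p where
  F := F
  D := 0
  pow_mem := hF
  apply_pow _ := rfl
  apply_add := by simp
  apply_mul := by simp

/-- Unfolding `ofSubfield`. [folklore] -/
@[simp] theorem ofSubfield_F (F : Subfield E) (hF : ∀ x : E, x ^ p ∈ F) :
    (ofSubfield p F hF).F = F := rfl

end PartialDerivation

/-- **Derivations with a prescribed zero set**: if `F ⊆ K` is a subfield containing all `p`-th
powers (`p = char K`) and `b ∉ F`, there is a derivation `D` of `K` with `D b = 1` and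
`D = 0` on `F`. [cite: Matsumura1987, §26 p. 202] -/
theorem exists_derivation_eq_one_eqOn_zero [Fact p.Prime] [CharP E p] (F : Subfield E)
    (hF : ∀ x : E, x ^ p ∈ F) {b : E} (hb : b ∉ F) :
    ∃ D : Derivation ℤ E E, D b = 1 ∧ ∀ x ∈ F, D x = 0 := by
  let P₀ := PartialDerivation.ofSubfield p F hF
  have hb₀ : b ∉ P₀.F := hb
  obtain ⟨Q, hle, hQ⟩ := (P₀.extend hb₀ 1).exists_extension_top
  refine ⟨Q.toDerivation hQ, ?_, fun x hx => ?_⟩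
  · rw [PartialDerivation.toDerivation_apply, hle.2 b (P₀.mem_extend_F hb₀ 1),
      P₀.extend_apply_self hb₀ 1]
  · rw [PartialDerivation.toDerivation_apply, hle.2 x (P₀.le_extend_F hb₀ 1 hx),
      P₀.extend_apply_of_mem hb₀ 1 hx]
    rfl

/-! ## `p`-free finite families and their dual derivations -/

/-- The subfield `K^p(S)` generated by the `p`-th powers and `S`. [folklore] -/
def pAdjoin [ExpChar E p] (S : Set E) : Subfield E :=
  Subfield.closure (Set.range (frobenius E p) ∪ S)

variable {p}

/-- `S ⊆ K^p(S)`. [folklore] -/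
theorem subset_pAdjoin [ExpChar E p] (S : Set E) : S ⊆ pAdjoin p S :=
  fun _ hx => Subfield.subset_closure (Or.inr hx)

/-- `p`-th powers lie in `K^p(S)`. [folklore] -/
theorem pow_mem_pAdjoin [ExpChar E p] (S : Set E) (x : E) : x ^ p ∈ pAdjoin p S :=
  Subfield.subset_closure (Or.inl ⟨x, frobenius_def ..⟩)

/-- `K^p(S)` is monotone in `S`. [folklore] -/
theorem pAdjoin_mono [ExpChar E p] {S T : Set E} (h : S ⊆ T) : pAdjoin p S ≤ pAdjoin p T :=
  Subfield.closure_mono (Set.union_subset_union_right _ h)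

variable (p) in
/-- A finite set `S ⊆ K` is **`p`-free** if no `s ∈ S` lies in `K^p(S ∖ {s})`. (For `p = char K`
this is implied by, and in fact equivalent to, Matsumura's `p`-independence over the prime
field; we only use the definition.) [cite: Matsumura1987, §26 p. 202] -/
def IsPFree [ExpChar E p] (S : Finset E) : Prop :=
  ∀ s ∈ S, s ∉ pAdjoin p ((↑S : Set E) \ {s})

/-- **Minimal `p`-generating subsets are `p`-free**: every finite `C ⊆ K` contains a `p`-free
`S` with `C ⊆ K^p(S)`. [folklore] -/
theorem exists_isPFree_subset [ExpChar E p] (C : Finset E) :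
    ∃ S : Finset E, S ⊆ C ∧ IsPFree p S ∧ (↑C : Set E) ⊆ pAdjoin p (↑S : Set E) := by
  classical
  -- subsets `T ⊆ C` with `C ⊆ K^p(T)`, of minimal cardinality
  let good : Finset E → Prop := fun T => T ⊆ C ∧ (↑C : Set E) ⊆ pAdjoin p (↑T : Set E)
  have hC : good C := ⟨Finset.Subset.refl _, subset_pAdjoin _⟩
  have hex : ∃ n, ∃ T, good T ∧ T.card = n := ⟨_, C, hC, rfl⟩
  obtain ⟨T, hT, hcard⟩ := Nat.find_spec hex
  refine ⟨T, hT.1, fun s hs hmem => ?_, hT.2⟩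
  -- removing `s` keeps `C ⊆ K^p(T ∖ {s})`, contradicting minimality
  have hsub : (↑T : Set E) ⊆ pAdjoin p (↑(T.erase s) : Set E) := by
    intro t ht
    by_cases hts : t = s
    · subst hts; rwa [Finset.coe_erase]
    · exact subset_pAdjoin _ (Finset.mem_erase.mpr ⟨hts, ht⟩)
  have hgood : good (T.erase s) := by
    refine ⟨(Finset.erase_subset s T).trans hT.1, hT.2.trans ?_⟩
    change pAdjoin p (↑T : Set E) ≤ pAdjoin p _
    rw [pAdjoin, Subfield.closure_le]
    refine Set.union_subset ?_ hsub
    rintro x ⟨y, rfl⟩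
    exact pow_mem_pAdjoin _ y
  have hmin := Nat.find_min' hex ⟨T.erase s, hgood, rfl⟩
  rw [← hcard, Finset.card_erase_of_mem hs] at hmin
  have := Finset.card_pos.mpr ⟨s, hs⟩
  omega

/-- **Dual derivations of a `p`-free family** (Matsumura §26: a map on a `p`-basis extends to a
derivation): for `S` `p`-free there are `∂_s ∈ Der(K)` with `∂_s(s) = 1` and `∂_s(t) = 0` for
`t ∈ S`, `t ≠ s`. [cite: Matsumura1987, §26 p. 202] -/
theorem exists_dual_derivation [Fact p.Prime] [CharP E p] {S : Finset E} (hS : IsPFree p S) :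
    ∃ δ : E → Derivation ℤ E E, ∀ s ∈ S, δ s s = 1 ∧ ∀ t ∈ S, t ≠ s → δ s t = 0 := by
  classical
  haveI : ExpChar E p := ExpChar.prime Fact.out
  have key : ∀ s ∈ S, ∃ D : Derivation ℤ E E, D s = 1 ∧ ∀ t ∈ S, t ≠ s → D t = 0 := by
    intro s hs
    obtain ⟨D, hD1, hD0⟩ := exists_derivation_eq_one_eqOn_zero p
      (pAdjoin p ((↑S : Set E) \ {s})) (pow_mem_pAdjoin _) (hS s hs)
    exact ⟨D, hD1, fun t ht hts => hD0 t (subset_pAdjoin _ ⟨ht, hts⟩)⟩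
  refine ⟨fun s => if hs : s ∈ S then (key s hs).choose else 0, fun s hs => ?_⟩
  simp only [dif_pos hs]
  exact (key s hs).choose_spec

/-! ## Expansion of a derivation along dual derivations -/

section Expansion

variable {M : Type v} [AddCommGroup M] [Module E M]

/-- **Two derivations of a field agreeing on a set agree on the subfield it generates** (the
equaliser of two derivations is a subfield: `D(a⁻¹) = -a⁻² D a`). [folklore] -/
theorem Derivation.eqOn_subfieldClosure {D₁ D₂ : Derivation ℤ E M} {s : Set E}
    (h : Set.EqOn D₁ D₂ s) : Set.EqOn D₁ D₂ (Subfield.closure s) := by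
  let F : Subfield E :=
    { carrier := {x | D₁ x = D₂ x}
      mul_mem' := fun {a b} ha hb => by
        change D₁ (a * b) = D₂ (a * b)
        rw [Derivation.leibniz, Derivation.leibniz, ha, hb]
      one_mem' := by change D₁ 1 = D₂ 1; rw [Derivation.map_one_eq_zero, Derivation.map_one_eq_zero]
      add_mem' := fun {a b} ha hb => by
        change D₁ (a + b) = D₂ (a + b)
        rw [map_add, map_add, ha, hb]
      zero_mem' := by change D₁ 0 = D₂ 0; rw [map_zero, map_zero]
      neg_mem' := fun {a} ha => by
        change D₁ (-a) = D₂ (-a)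
        rw [map_neg, map_neg, ha]
      inv_mem' := fun a ha => by
        change D₁ a⁻¹ = D₂ a⁻¹
        rw [Derivation.leibniz_inv, Derivation.leibniz_inv, ha] }
  exact fun x hx => (Subfield.closure_le (t := F)).mpr h hx

/-- Evaluating a finite sum of derivations. [folklore] -/
theorem Derivation.finset_sum_apply {ι : Type*} (s : Finset ι) (f : ι → Derivation ℤ E M)
    (x : E) : (∑ i ∈ s, f i) x = ∑ i ∈ s, f i x := by
  induction s using Finset.cons_induction with
  | empty => simp
  | cons a s has ih => rw [Finset.sum_cons, Finset.sum_cons, Derivation.add_apply, ih]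

variable [Fact p.Prime] [CharP E p]

omit [Fact p.Prime] in
/-- A derivation of a field of characteristic `p` kills `p`-th powers. [folklore] -/
theorem Derivation.apply_pow_char (D : Derivation ℤ E M) (x : E) : D (x ^ p) = 0 := by
  rw [Derivation.leibniz_pow, ← Nat.cast_smul_eq_nsmul E, CharP.cast_eq_zero, zero_smul]

/-- **Expansion along dual derivations** (Matsumura Thm. 30.5, proof: the differentials
`df_j` only involve finitely many `du_γ`): let `S` be a finite family with dual derivations
`∂_s` (`∂_s t = δ_{st}` on `S`). Then for every derivation `d` of `K` into a `K`-vector space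
and every `c ∈ K^p(S)`, `d c = Σ_{s ∈ S} ∂_s(c) • d(s)`. [cite: Matsumura1987, §26 p. 202 and
Thm. 30.5 (proof)] -/
theorem derivation_apply_eq_sum_dual {S : Finset E} {δ : E → Derivation ℤ E E}
    (hδ : ∀ s ∈ S, δ s s = 1 ∧ ∀ t ∈ S, t ≠ s → δ s t = 0) (d : Derivation ℤ E M) {c : E}
    (hc : c ∈ pAdjoin p (↑S : Set E)) : d c = ∑ s ∈ S, δ s c • d s := by
  classical
  haveI : ExpChar E p := ExpChar.prime Fact.out
  -- the right-hand side as a derivation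
  let D₂ : Derivation ℤ E M := ∑ s ∈ S, (LinearMap.toSpanSingleton E M (d s)).compDer (δ s)
  have hD₂ : ∀ x : E, D₂ x = ∑ s ∈ S, δ s x • d s := fun x => by
    rw [Derivation.finset_sum_apply]
    rfl
  suffices h : Set.EqOn d D₂ (pAdjoin p (↑S : Set E)) by rw [h hc, hD₂]
  apply Derivation.eqOn_subfieldClosure
  rintro x (⟨y, rfl⟩ | hx)
  · change d (y ^ p) = D₂ (y ^ p)
    rw [hD₂, Derivation.apply_pow_char d]
    symm
    exact Finset.sum_eq_zero fun s _ => by rw [Derivation.apply_pow_char (δ s), zero_smul]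
  · rw [hD₂, Finset.sum_eq_single_of_mem x hx fun s hs hsx => by
      rw [(hδ s hs).2 x hx (Ne.symm hsx), zero_smul], (hδ x hx).1, one_smul]

end Expansion

end Literature.FieldTheory.Separability

end
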